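import Mathlib
import HarnessLib
import Literature.AlgebraicGeometry.HyperbolicPolynomials.SpectrahedralShadow
import Summits.ValiantsHypothesis.ValiantsHypothesis.Theorems.PermanentalConesHyperbolicVPShadowStubRealifyHermitianPencil
import Summits.ValiantsHypothesis.ValiantsHypothesis.Theorems.PermanentalConesHyperbolicVPShadowStubSpectrahedronOfSymmDetPower

/-!
# ValiantsHypothesis / PermanentalCones — `HyperbolicVPShadow`, stub Iʰ

Route `PermanentalCones`, item `stmt-ValiantsHypothesis-8655` (crux `HyperbolicVPShadow`), line
`birth`, stub `stub_oshimeFamilyIh_spectrahedron`.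

Family (I) of Oshime's classification of non-symmetrisable linear pencils of real `3 × 3`
matrices with only real eigenvalues (Oshime 1991, Prop 4.6 / Thm 7.3(2): the non-uniformly
diagonalisable extension of Petrovsky's pair), *homogenised*: `P(x) = x₀ 1 + x₁ A + x₂ B + x₃ C`
with `A = diag(1, 0, 0)`, `B = E₁₂ + E₂₁ + E₂₃ = !![0, 1, 0; 1, 0, 1; 0, 0, 0]`,
`C = !![0, β, -γ; β (1 - a), 1, 0; -2a, 0, -1]`; it is hyperbolic iff `0 < a < 1`, `γ > β²/8`,
and we work on the closure `0 ≤ a ≤ 1`, `β² ≤ 8γ` of the parameter region. We show that its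
closed nonnegative-spectrum cone `{x : ∀ τ > 0, det (P x + τ·1) ≠ 0}` is a lifted-LMI set of
size `6`.

## Proof

With `t := τ + x₀`, `(x, y, z) := (x₁, x₂, x₃)` one has
`det (t·1 + xA + yB + zC) = (t+x)(t²−z²) − (1−a)(y+βz)²(t−z) − a(y² + βyz + 2γz²)(t+z)`.
There is a *Hermitian* determinantal certificate: with reals `u₁, u₂, m`,
`u₁² = 1 − a`, `u₂² = a`, `m² = 2γ − β²/4` (`permanentalCones_oshimeI_certificate`, square
roots), the Hermitian matrix
`Hmat := !![t + x, u₁ (y + βz), u₂ y + (p − q i) z; u₁ (y + βz), t + z, 0; u₂ y + (p + q i) z, 0, t − z]`,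
`p := u₂ β/2`, `q := u₂ m`, has `det Hmat = det (t·1 + xA + yB + zC)` identically
(`permanentalCones_oshimeI_detIdentity`, a polynomial identity modulo the three relations).
Realifying the Hermitian pencil `H x = x₀ 1 + x₁ Aℂ + x₂ Bℂ + x₃ Cert`
(`stub_realify_hermitianPencil`) gives a real symmetric pencil `L` of size `2·3` with
`det (L x + τ·1) = det (P x + τ·1)²`, and `stub_spectrahedron_of_symmDetPower` (`k = 2`) turns
this into a size-`6` lifted-LMI description of the cone. No definitions are introduced: all
matrices are literals, the two pencils are `Fintype.linearCombination ℝ ![…]`.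
-/

-- `<Problem> = <Summit>` for this single-conjunct summit (lakefile sets the same option tree-wide).
set_option linter.dupNamespace false

namespace Summit.ValiantsHypothesis.ValiantsHypothesis.Theorems

open Matrix Complex

/-- **Parameters of the Hermitian certificate for Oshime's family (I).** If `0 ≤ a ≤ 1` and
`β² ≤ 8γ`, then there are real `u₁, u₂, m` with `u₁² = 1 − a`, `u₂² = a` and `m² = 2γ − β²/4`
(certificate for Oshime 1991, Prop 4.6 / Thm 7.3(2), family (I)). [folklore] -/
theorem permanentalCones_oshimeI_certificate (a β γ : ℝ) (ha₀ : 0 ≤ a) (ha₁ : a ≤ 1)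
    (hβγ : β ^ 2 ≤ 8 * γ) :
    ∃ u₁ u₂ m : ℝ, u₁ ^ 2 = 1 - a ∧ u₂ ^ 2 = a ∧ m ^ 2 = 2 * γ - β ^ 2 / 4 :=
  ⟨Real.sqrt (1 - a), Real.sqrt a, Real.sqrt (2 * γ - β ^ 2 / 4), Real.sq_sqrt (by linarith),
    Real.sq_sqrt ha₀, Real.sq_sqrt (by linarith)⟩

/-- **The Hermitian determinantal identity for Oshime's family (I).** Under the three relations
of `permanentalCones_oshimeI_certificate` (with `p = u₂ β/2`, `q = u₂ m`),
`det Hmat = det (t·1 + xA + yB + zC)` for the Hermitian matrix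
`Hmat = !![t + x, u₁ (y + βz), u₂ y + (p − q i) z; u₁ (y + βz), t + z, 0; u₂ y + (p + q i) z, 0, t − z]`,
both sides written out as explicit `3 × 3` matrices (Oshime 1991, Prop 4.6 / Thm 7.3(2),
family (I)). [folklore] -/
theorem permanentalCones_oshimeI_detIdentity (a β γ u₁ u₂ m p q : ℝ)
    (hp : p = u₂ * (β / 2)) (hq : q = u₂ * m)
    (R1 : u₁ ^ 2 = 1 - a) (R2 : u₂ ^ 2 = a) (R3 : m ^ 2 = 2 * γ - β ^ 2 / 4) (t x y z : ℝ) :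
    (!![(t : ℂ) + x, u₁ * (y + β * z), u₂ * y + (p - q * I) * z;
        u₁ * (y + β * z), t + z, 0;
        u₂ * y + (p + q * I) * z, 0, t - z]).det =
      ((!![t + x, y + β * z, -γ * z; y + β * (1 - a) * z, t + z, y;
          -2 * a * z, 0, t - z]).det : ℂ) := by
  subst hp hq
  have R1c : (u₁ : ℂ) ^ 2 = 1 - a := by exact_mod_cast R1
  have R2c : (u₂ : ℂ) ^ 2 = a := by exact_mod_cast R2
  have R3c : (m : ℂ) ^ 2 = 2 * γ - β ^ 2 / 4 := by exact_mod_cast R3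
  simp only [Matrix.det_fin_three, Matrix.of_apply, Matrix.cons_val', Matrix.cons_val_zero,
    Matrix.cons_val_one, Matrix.cons_val_two, Matrix.head_cons, Matrix.tail_cons,
    Matrix.empty_val', Matrix.cons_val_fin_one, Matrix.head_fin_const]
  push_cast
  -- the two cofactor expansions differ by `-(t-z)(y+βz)² ρ₁ - (t+z)((y+βz/2)² + m²z²) ρ₂
  -- - a (t+z) z² ρ₃`, `ρᵢ` the defects of the three relations, plus a multiple of `I² + 1`
  linear_combination (-((t : ℂ) - z) * (y + β * z) ^ 2) * R1c
    + (-((t : ℂ) + z) * ((y + β / 2 * z) ^ 2 + m ^ 2 * z ^ 2)) * R2c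
    + (-(a : ℂ) * (t + z) * z ^ 2) * R3c
    + (((t : ℂ) + z) * u₂ ^ 2 * m ^ 2 * z ^ 2) * I_sq

/-- **Stub (Oshime's family (I), homogenised, has size-`6` spectrahedral cones).** For
`0 ≤ a ≤ 1` and `β² ≤ 8γ`, the closed nonnegative-spectrum cone
`{x : ∀ τ > 0, det (x₀ 1 + x₁ A + x₂ B + x₃ C + τ·1) ≠ 0}` of the homogenised real-spectrum
pencil `A = diag(1,0,0)`, `B = !![0, 1, 0; 1, 0, 1; 0, 0, 0]`,
`C = !![0, β, -γ; β (1 - a), 1, 0; -2a, 0, -1]` (Oshime 1991, Prop 4.6 / Thm 7.3(2), family (I))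
is a lifted-LMI set of size `6`: a Hermitian `3 × 3` determinantal representation, realified to
a symmetric `6 × 6` representation of the square of `det (P x + τ·1)`. [folklore] -/
theorem stub_oshimeFamilyIh_spectrahedron :
    ∀ a β γ : ℝ, 0 ≤ a → a ≤ 1 → β ^ 2 ≤ 8 * γ →
      Literature.AlgebraicGeometry.HyperbolicPolynomials.IsSpectrahedralShadowOfSize
        {x : Fin 4 → ℝ | ∀ τ : ℝ, 0 < τ →
          (x 0 • (1 : Matrix (Fin 3) (Fin 3) ℝ) + x 1 • !![(1 : ℝ), 0, 0; 0, 0, 0; 0, 0, 0] +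
            x 2 • !![(0 : ℝ), 1, 0; 1, 0, 1; 0, 0, 0] +
            x 3 • !![0, β, -γ; β * (1 - a), 1, 0; -2 * a, 0, -1] +
            τ • (1 : Matrix (Fin 3) (Fin 3) ℝ)).det ≠ 0} 6 := by
  intro a β γ ha₀ ha₁ hβγ
  obtain ⟨u₁, u₂, m, R1, R2, R3⟩ := permanentalCones_oshimeI_certificate a β γ ha₀ ha₁ hβγ
  obtain ⟨p, hp⟩ : ∃ p : ℝ, p = u₂ * (β / 2) := ⟨_, rfl⟩
  obtain ⟨q, hq⟩ : ∃ q : ℝ, q = u₂ * m := ⟨_, rfl⟩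
  -- the real pencil `P x = x 0 • 1 + x 1 • A + x 2 • B + x 3 • C`
  let P : (Fin 4 → ℝ) →ₗ[ℝ] Matrix (Fin 3) (Fin 3) ℝ := Fintype.linearCombination ℝ
    ![(1 : Matrix (Fin 3) (Fin 3) ℝ), !![(1 : ℝ), 0, 0; 0, 0, 0; 0, 0, 0],
      !![(0 : ℝ), 1, 0; 1, 0, 1; 0, 0, 0], !![0, β, -γ; β * (1 - a), 1, 0; -2 * a, 0, -1]]
  have hP : ∀ x : Fin 4 → ℝ, P x = x 0 • (1 : Matrix (Fin 3) (Fin 3) ℝ) +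
      x 1 • !![(1 : ℝ), 0, 0; 0, 0, 0; 0, 0, 0] + x 2 • !![(0 : ℝ), 1, 0; 1, 0, 1; 0, 0, 0] +
      x 3 • !![0, β, -γ; β * (1 - a), 1, 0; -2 * a, 0, -1] := fun x => by
    simp only [P, Fintype.linearCombination_apply, Fin.sum_univ_four, Matrix.cons_val_zero,
      Matrix.cons_val_one, Matrix.cons_val_two, Matrix.cons_val_three, Matrix.head_cons,
      Matrix.tail_cons]
  have hPx : ∀ (x : Fin 4 → ℝ) (τ : ℝ), P x + τ • (1 : Matrix (Fin 3) (Fin 3) ℝ) =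
      !![τ + x 0 + x 1, x 2 + β * x 3, -γ * x 3; x 2 + β * (1 - a) * x 3, τ + x 0 + x 3, x 2;
        -2 * a * x 3, 0, τ + x 0 - x 3] := fun x τ => by
    rw [hP]
    ext i j
    fin_cases i <;> fin_cases j <;> simp <;> ring
  -- the Hermitian pencil `H x = x 0 • 1 + x 1 • Aℂ + x 2 • Bℂ + x 3 • Cert`
  let Aℂ : Matrix (Fin 3) (Fin 3) ℂ := !![1, 0, 0; 0, 0, 0; 0, 0, 0]
  let Bℂ : Matrix (Fin 3) (Fin 3) ℂ := !![0, (u₁ : ℂ), (u₂ : ℂ); (u₁ : ℂ), 0, 0; (u₂ : ℂ), 0, 0]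
  let Cert : Matrix (Fin 3) (Fin 3) ℂ :=
    !![0, (u₁ : ℂ) * β, (p : ℂ) - q * I; (u₁ : ℂ) * β, 1, 0; (p : ℂ) + q * I, 0, -1]
  have hIh : (1 : Matrix (Fin 3) (Fin 3) ℂ).IsHermitian := Matrix.isHermitian_one
  have hAh : Aℂ.IsHermitian := Matrix.IsHermitian.ext fun i j => by
    fin_cases i <;> fin_cases j <;> simp [Aℂ]
  have hBh : Bℂ.IsHermitian := Matrix.IsHermitian.ext fun i j => by
    fin_cases i <;> fin_cases j <;> simp [Bℂ]
  have hCh : Cert.IsHermitian := Matrix.IsHermitian.ext fun i j => by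
    fin_cases i <;> fin_cases j <;> simp [Cert, Complex.ext_iff]
  let H : (Fin 4 → ℝ) →ₗ[ℝ] Matrix (Fin 3) (Fin 3) ℂ :=
    Fintype.linearCombination ℝ ![(1 : Matrix (Fin 3) (Fin 3) ℂ), Aℂ, Bℂ, Cert]
  have hH : ∀ x : Fin 4 → ℝ, H x = x 0 • (1 : Matrix (Fin 3) (Fin 3) ℂ) + x 1 • Aℂ + x 2 • Bℂ +
      x 3 • Cert := fun x => by
    simp only [H, Fintype.linearCombination_apply, Fin.sum_univ_four, Matrix.cons_val_zero,
      Matrix.cons_val_one, Matrix.cons_val_two, Matrix.cons_val_three, Matrix.head_cons,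
      Matrix.tail_cons]
  have hHerm : ∀ x : Fin 4 → ℝ, (H x).IsHermitian := fun x => by
    rw [hH]
    exact (((hIh.smul (IsSelfAdjoint.all _)).add (hAh.smul (IsSelfAdjoint.all _))).add
      (hBh.smul (IsSelfAdjoint.all _))).add (hCh.smul (IsSelfAdjoint.all _))
  have hHx : ∀ (x : Fin 4 → ℝ) (τ : ℝ), H x + (τ : ℂ) • (1 : Matrix (Fin 3) (Fin 3) ℂ) =
      !![(((τ + x 0 : ℝ) : ℂ)) + x 1, u₁ * (x 2 + β * x 3), u₂ * x 2 + (p - q * I) * x 3;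
        u₁ * (x 2 + β * x 3), ((τ + x 0 : ℝ) : ℂ) + x 3, 0;
        u₂ * x 2 + (p + q * I) * x 3, 0, ((τ + x 0 : ℝ) : ℂ) - x 3] := fun x τ => by
    rw [hH]
    ext i j
    fin_cases i <;> fin_cases j <;> simp [Aℂ, Bℂ, Cert, Matrix.smul_apply] <;> ring
  -- the determinantal identity `det (H x + τ·1) = det (P x + τ·1)`
  have hdet : ∀ (x : Fin 4 → ℝ) (τ : ℝ), (H x + (τ : ℂ) • (1 : Matrix (Fin 3) (Fin 3) ℂ)).det =
      (((P x + τ • (1 : Matrix (Fin 3) (Fin 3) ℝ)).det : ℝ) : ℂ) := fun x τ => by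
    rw [hHx, hPx]
    exact permanentalCones_oshimeI_detIdentity a β γ u₁ u₂ m p q hp hq R1 R2 R3 (τ + x 0) (x 1)
      (x 2) (x 3)
  -- realification: a symmetric pencil of size `2·3` representing the square of `det (P x + τ·1)`
  obtain ⟨L, hLsymm, hLdet⟩ := stub_realify_hermitianPencil 4 3 H hHerm
  have hLdet' : ∀ (x : Fin 4 → ℝ) (τ : ℝ),
      (L x + τ • (1 : Matrix (Fin (2 * 3)) (Fin (2 * 3)) ℝ)).det =
        ((P x + τ • (1 : Matrix (Fin 3) (Fin 3) ℝ)).det) ^ 2 := fun x τ => by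
    have h := hLdet x τ
    simp only [Complex.coe_algebraMap] at h
    have hs : star (((P x + τ • (1 : Matrix (Fin 3) (Fin 3) ℝ)).det : ℝ) : ℂ) =
        ((P x + τ • (1 : Matrix (Fin 3) (Fin 3) ℝ)).det : ℝ) := Complex.conj_ofReal _
    rw [hdet x τ, hs, ← Complex.ofReal_mul] at h
    rw [sq]
    exact_mod_cast h
  have h6 := stub_spectrahedron_of_symmDetPower 4 3 (2 * 3) 2 P L two_ne_zero hLsymm hLdet'
  simp only [hP] at h6
  exact h6

end Summit.ValiantsHypothesis.ValiantsHypothesis.Theorems
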